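import Literature.Analysis.FluidPDE.ConfinedHardSphereFlowShortBad
import Literature.Analysis.FluidPDE.ConfinedHardSphereFlowMeasurable
import Literature.Analysis.FluidPDE.HardSphereScattering
import HarnessLib

/-!
# The confined hard-sphere flow over a short window does not lose volume

Ninth layer of the proof of `ConfinedHardSphereFlow.nonempty_torus_balls` (existence of the
confined hard-sphere flow on the torus among fixed round scatterers; Cercignani–Illner–Pulvirenti
1994 §4.2 p. 65 "preserves Lebesgue measure", Thm. 4.2.1, App. 4.A; Gallagher–Saint-Raymond–Texier
2013, proof of Prop. 4.1.1: "since the measure is invariant by the flow"): for every measurable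
`B`, the confined short-time good data of an energy shell that the confined flow at time `δ`
carries into `B` have volume at most `vol B` (`volume_cShortGood_inter_preimage_fwdFlow_le`).
As in `Literature.Analysis.FluidPDE.HardSphereScattering` (wall-free case, whose free-flight,
shear and two-body results are reused), the flow at time `δ` is `S_δ ∘ cKick` on `cShortGood`,
it is injective there, and each kick preserves the volume of sets: the new ingredient is the
wall kick `wallCollide`, i.e. the one-particle billiard `phaseBilliard ρ` of `HardSphereScattering`
in torus coordinates centred at the scatterer, transported through `Alexander.applyAt`.

Contents: measurability of the wall pieces and of `cShortGood`; the wall kick as a conjugate of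
`phaseBilliard` by a translation (`wallKickOne_eq`), its injectivity and volume rule
(`volume_image_wallCollide`); the pieces `cShortPiece` of `cShortGood` (finite index, disjoint,
volume-preserving images); the window estimate.

## References

* C. Cercignani, R. Illner, M. Pulvirenti, *The Mathematical Theory of Dilute Gases*, Springer
  (1994), §4.2 p. 65, App. 4.A pp. 107–111.
* I. Gallagher, L. Saint-Raymond, B. Texier, *From Newton to Boltzmann* (2013), Prop. 4.1.1.
-/

open Set Filter Function MeasureTheory Metric
open scoped ENNReal Topology InnerProductSpace

namespace Literature.Analysis.FluidPDE

noncomputable section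

section Kinetic

namespace ConfinedAlexander

variable {d : Type*} [Fintype d] {N : ℕ} {ι : Type*} {ctr : ι → UnitAddTorus d} {ρ : ℝ} {hρ : 0 < ρ} {ε r δ V : ℝ}

/-! ## Measurability of the wall pieces and of the confined short-time good set -/

section Measurability

/-- The relative data `(x_i - c, v_i)` of a sphere and a centre depend measurably on the datum. [folklore] -/
theorem measurable_wallData_config (i : Fin N) (c : UnitAddTorus d) :
    Measurable fun z : Config N d (UnitAddTorus d) =>
      (((Torus.geometry d).sepVec (z i).1 c, (z i).2) : EuclideanSpace ℝ d × EuclideanSpace ℝ d) :=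
  (Torus.isMeasurable_geometry.measurable_sepVec_config_point i c).prodMk (Geometry.IsMeasurable.measurable_vel i)

/-- `wallFar` is measurable. [folklore] -/
theorem measurableSet_wallFar [Countable ι] (ctr : ι → UnitAddTorus d) (ρ r : ℝ) :
    MeasurableSet (wallFar (d := d) N ctr ρ r) := by
  have : wallFar (d := d) N ctr ρ r = ⋂ i : Fin N, ⋂ k : ι, {z | ρ + r < ‖(Torus.geometry d).sepVec (z i).1 (ctr k)‖} := by
    ext z; simp only [wallFar, mem_setOf_eq, mem_iInter]
  rw [this]
  exact MeasurableSet.iInter fun i => MeasurableSet.iInter fun k =>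
    measurableSet_lt measurable_const (measurable_norm_sepVec_point i (ctr k))

/-- `WallOthersFar` cuts out a measurable set. [folklore] -/
theorem measurableSet_wallOthersFar [Countable ι] (ctr : ι → UnitAddTorus d) (ρ r : ℝ) (q : Fin N × ι) :
    MeasurableSet {z : Config N d (UnitAddTorus d) | WallOthersFar ctr ρ r z q} := by
  haveI : Countable (Fin N × ι) := inferInstance
  have : {z : Config N d (UnitAddTorus d) | WallOthersFar ctr ρ r z q} =
      ⋂ q' : Fin N × ι, {z | q' ≠ q → z ∈ {z | ρ + r < ‖(Torus.geometry d).sepVec (z q'.1).1 (ctr q'.2)‖}} := by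
    ext z; simp only [WallOthersFar, mem_setOf_eq, mem_iInter]
  rw [this]
  exact MeasurableSet.iInter fun q' => (MeasurableSet.const _).imp
    (measurableSet_lt measurable_const (measurable_norm_sepVec_point q'.1 (ctr q'.2)))

/-- The hitting time of a sphere with a scatterer is a measurable function of the datum. [folklore] -/
theorem measurable_pairHitTime_point (ρ : ℝ) (i : Fin N) (c : UnitAddTorus d) :
    Measurable fun z : Config N d (UnitAddTorus d) => pairHitTime ρ ((Torus.geometry d).sepVec (z i).1 c) (z i).2 := by
  have hτ : Measurable fun u : EuclideanSpace ℝ d × EuclideanSpace ℝ d => pairHitTime ρ u.1 u.2 := by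
    unfold pairHitTime pairDisc
    fun_prop
  have h := hτ.comp (measurable_wallData_config i c)
  simpa only [Function.comp_def] using h

/-- `PairHits` of a sphere with a scatterer cuts out a measurable set. [folklore] -/
theorem measurableSet_pairHits_point (ρ : ℝ) (i : Fin N) (c : UnitAddTorus d) :
    MeasurableSet {z : Config N d (UnitAddTorus d) | PairHits ρ ((Torus.geometry d).sepVec (z i).1 c) (z i).2} := by
  have h1 : Measurable fun u : EuclideanSpace ℝ d × EuclideanSpace ℝ d => ⟪u.1, u.2⟫_ℝ := by fun_prop
  have h2 : Measurable fun u : EuclideanSpace ℝ d × EuclideanSpace ℝ d => pairDisc ρ u.1 u.2 := by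
    unfold pairDisc
    fun_prop
  have hs : MeasurableSet {u : EuclideanSpace ℝ d × EuclideanSpace ℝ d | PairHits ρ u.1 u.2} :=
    (measurableSet_lt h1 measurable_const).inter (measurableSet_le measurable_const h2)
  exact measurable_wallData_config i c hs

/-- The wall no-hit pieces are measurable. [folklore] -/
theorem measurableSet_wallNoHitPiece [Countable ι] (ctr : ι → UnitAddTorus d) (ε ρ r δ : ℝ) (q : Fin N × ι) :
    MeasurableSet (wallNoHitPiece (d := d) N ctr ε ρ r δ q) := by
  have h : wallNoHitPiece (d := d) N ctr ε ρ r δ q = Alexander.farSet N ε r ∩ ({z | WallOthersFar ctr ρ r z q} ∩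
      ({z | ρ < ‖(Torus.geometry d).sepVec (z q.1).1 (ctr q.2)‖} ∩
        ({z | ‖(Torus.geometry d).sepVec (z q.1).1 (ctr q.2)‖ ≤ ρ + r} ∩
          ({z : Config N d (UnitAddTorus d) | PairHits ρ ((Torus.geometry d).sepVec (z q.1).1 (ctr q.2)) (z q.1).2}ᶜ ∪
            {z | δ < pairHitTime ρ ((Torus.geometry d).sepVec (z q.1).1 (ctr q.2)) (z q.1).2})))) := by
    ext z
    simp only [wallNoHitPiece, mem_setOf_eq, mem_inter_iff, mem_union, mem_compl_iff]
  rw [h]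
  exact (Alexander.measurableSet_farSet ε r).inter ((measurableSet_wallOthersFar ctr ρ r q).inter
    ((measurableSet_lt measurable_const (measurable_norm_sepVec_point q.1 (ctr q.2))).inter
      ((measurableSet_le (measurable_norm_sepVec_point q.1 (ctr q.2)) measurable_const).inter
        ((measurableSet_pairHits_point ρ q.1 (ctr q.2)).compl.union
          (measurableSet_lt measurable_const (measurable_pairHitTime_point ρ q.1 (ctr q.2)))))))

/-- The wall hit pieces are measurable. [folklore] -/
theorem measurableSet_wallHitPiece [Countable ι] (ctr : ι → UnitAddTorus d) (ε ρ r δ : ℝ) (q : Fin N × ι) :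
    MeasurableSet (wallHitPiece (d := d) N ctr ε ρ r δ q) := by
  have h : wallHitPiece (d := d) N ctr ε ρ r δ q = Alexander.farSet N ε r ∩ ({z | WallOthersFar ctr ρ r z q} ∩
      ({z | ‖(Torus.geometry d).sepVec (z q.1).1 (ctr q.2)‖ ≤ ρ + r} ∩
        ((fun z : Config N d (UnitAddTorus d) =>
            (((Torus.geometry d).sepVec (z q.1).1 (ctr q.2), (z q.1).2) : EuclideanSpace ℝ d × EuclideanSpace ℝ d)) ⁻¹'
              billiardGood ρ ∩
          {z | pairHitTime ρ ((Torus.geometry d).sepVec (z q.1).1 (ctr q.2)) (z q.1).2 ≤ δ}))) := by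
    ext z
    simp only [wallHitPiece, mem_setOf_eq, mem_inter_iff, mem_preimage]
  have hgood : MeasurableSet (billiardGood ρ : Set (EuclideanSpace ℝ d × EuclideanSpace ℝ d)) :=
    (isOpen_billiardGood ρ).measurableSet
  rw [h]
  exact (Alexander.measurableSet_farSet ε r).inter ((measurableSet_wallOthersFar ctr ρ r q).inter
    ((measurableSet_le (measurable_norm_sepVec_point q.1 (ctr q.2)) measurable_const).inter
      ((measurableSet_preimage (measurable_wallData_config q.1 (ctr q.2)) hgood).inter
        (measurableSet_le (measurable_pairHitTime_point ρ q.1 (ctr q.2)) measurable_const))))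

/-- The confined short-time good set is measurable. [folklore] -/
theorem measurableSet_cShortGood [Countable ι] (ctr : ι → UnitAddTorus d) (ε ρ r δ : ℝ) :
    MeasurableSet (cShortGood (d := d) N ctr ε ρ r δ) := by
  haveI : Countable (Fin N × ι) := inferInstance
  exact ((Alexander.measurableSet_shortGood ε r δ).inter (measurableSet_wallFar ctr ρ r)).union
    (MeasurableSet.iUnion fun q => (measurableSet_wallNoHitPiece ctr ε ρ r δ q).union (measurableSet_wallHitPiece ctr ε ρ r δ q))

end Measurability

/-! ## The wall kick as a conjugate of the one-particle billiard -/

section WallKick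

omit [Fintype d] in
/-- `shiftPos (-c)` undoes `shiftPos c`. [folklore] -/
@[simp]
theorem shiftPos_neg_shiftPos (c : UnitAddTorus d) (a : UnitAddTorus d × EuclideanSpace ℝ d) :
    shiftPos (-c) (shiftPos c a) = a := by
  simp [shiftPos]

omit [Fintype d] in
/-- `shiftPos c` undoes `shiftPos (-c)`. [folklore] -/
@[simp]
theorem shiftPos_shiftPos_neg (c : UnitAddTorus d) (a : UnitAddTorus d × EuclideanSpace ℝ d) :
    shiftPos c (shiftPos (-c) a) = a := by
  simp [shiftPos]

/-- `shiftPos c` preserves Haar × Lebesgue measure. [folklore] -/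
theorem measurePreserving_shiftPos (c : UnitAddTorus d) :
    MeasurePreserving (shiftPos (d := d) c) volume volume := by
  have h : (shiftPos (d := d) c) = Prod.map (· + c) id := by funext a; rfl
  rw [h, Measure.volume_eq_prod]
  exact (measurePreserving_add_right volume c).prod (MeasurePreserving.id volume)

omit [Fintype d] in
/-- The image of a set under `shiftPos c` is its preimage under `shiftPos (-c)`. [folklore] -/
theorem image_shiftPos (c : UnitAddTorus d) (Y : Set (UnitAddTorus d × EuclideanSpace ℝ d)) :
    shiftPos c '' Y = shiftPos (-c) ⁻¹' Y :=
  congrFun (image_eq_preimage_of_inverse (shiftPos_neg_shiftPos c) (shiftPos_shiftPos_neg c)) Y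

/-- `shiftPos` preserves the volume and the measurability of sets. [folklore] -/
theorem volume_image_shiftPos (c : UnitAddTorus d) {Y : Set (UnitAddTorus d × EuclideanSpace ℝ d)} (hY : MeasurableSet Y) :
    MeasurableSet (shiftPos c '' Y) ∧ volume (shiftPos c '' Y) = volume Y := by
  rw [image_shiftPos]
  exact ⟨(measurePreserving_shiftPos (-c)).measurable hY,
    (measurePreserving_shiftPos (-c)).measure_preimage hY.nullMeasurableSet⟩

/-- The chart datum of the shifted one-particle datum is the wall datum. [folklore] -/
theorem liftPhase_shiftPos_neg (c : UnitAddTorus d) (a : UnitAddTorus d × EuclideanSpace ℝ d) :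
    Alexander.liftPhase (shiftPos (-c) a) = wallData c a := by
  simp only [Alexander.liftPhase, shiftPos, wallData, Torus.geometry_sepVec, ← sub_eq_add_neg]

/-- **The wall kick is the one-particle billiard conjugated by the translation to the centre**:
`wallKickOne ρ c = shiftPos c ∘ phaseBilliard ρ ∘ shiftPos (-c)`. [folklore] -/
theorem wallKickOne_eq (ρ : ℝ) (c : UnitAddTorus d) (a : UnitAddTorus d × EuclideanSpace ℝ d) :
    wallKickOne ρ c a = shiftPos c (Alexander.phaseBilliard ρ (shiftPos (-c) a)) := by
  rw [Alexander.phaseBilliard, liftPhase_shiftPos_neg]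
  have hproj : FunctionSpaces.Torus.proj (wallData c a).1 = a.1 - c := by
    simp only [wallData, Torus.geometry_sepVec, Torus.proj_reprSym]
  have h2 : (wallData c a).2 = a.2 := rfl
  refine Prod.ext ?_ rfl
  simp only [Alexander.projPhase, billiardMap, shiftPos, wallKickOne, hitPoint, h2]
  rw [show (wallData c a).1 + pairHitTime ρ (wallData c a).1 a.2 • a.2 -
      pairHitTime ρ (wallData c a).1 a.2 • hitVel ρ (wallData c a) =
      (wallData c a).1 + pairHitTime ρ (wallData c a).1 a.2 • (a.2 - hitVel ρ (wallData c a)) by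
        rw [smul_sub]; abel,
    FunctionSpaces.Torus.proj_add, hproj]
  abel

/-- The good domain is measurable. [folklore] -/
theorem measurableSet_wallKickGood (ρ ρc : ℝ) (c : UnitAddTorus d) : MeasurableSet (wallKickGood (d := d) ρ ρc c) :=
  (measurePreserving_shiftPos (-c)).measurable (Alexander.measurableSet_phaseGood ρ ρc)

/-- The wall kick is measurable. [folklore] -/
theorem measurable_wallKickOne (ρ : ℝ) (c : UnitAddTorus d) : Measurable (wallKickOne (d := d) ρ c) := by
  have h : wallKickOne (d := d) ρ c = shiftPos c ∘ Alexander.phaseBilliard ρ ∘ shiftPos (-c) :=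
    funext fun a => wallKickOne_eq ρ c a
  rw [h]
  exact (measurePreserving_shiftPos c).measurable.comp ((Alexander.measurable_phaseBilliard ρ).comp
    (measurePreserving_shiftPos (-c)).measurable)

/-- The wall kick is injective on its good domain (`ρc < 1/2`). [folklore] -/
theorem injOn_wallKickOne {ρ ρc : ℝ} (hρ0 : 0 < ρ) (hρc : ρc < 1 / 2) (c : UnitAddTorus d) :
    InjOn (wallKickOne (d := d) ρ c) (wallKickGood ρ ρc c) := by
  intro a ha a' ha' heq
  have ha₁ : shiftPos (-c) a ∈ Alexander.phaseGood ρ ρc := ha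
  have ha₁' : shiftPos (-c) a' ∈ Alexander.phaseGood ρ ρc := ha'
  have h1 : Alexander.phaseBilliard ρ (shiftPos (-c) a) = Alexander.phaseBilliard ρ (shiftPos (-c) a') := by
    have h := congrArg (shiftPos (-c)) heq
    rw [wallKickOne_eq, wallKickOne_eq, shiftPos_neg_shiftPos, shiftPos_neg_shiftPos] at h
    exact h
  have h2 : shiftPos (-c) a = shiftPos (-c) a' := Alexander.injOn_phaseBilliard hρ0 hρc ha₁ ha₁' h1
  have h3 := congrArg (shiftPos c) h2
  rw [shiftPos_shiftPos_neg, shiftPos_shiftPos_neg] at h3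
  exact h3

/-- **The wall kick preserves the volume of sets** in its good domain. [cite: CIP1994, §4.2 p. 65] -/
theorem volume_image_wallKickOne {ρ ρc : ℝ} (hρ0 : 0 < ρ) (hρc : ρc < 1 / 2) (c : UnitAddTorus d)
    {Y : Set (UnitAddTorus d × EuclideanSpace ℝ d)} (hY : MeasurableSet Y) (hsub : Y ⊆ wallKickGood ρ ρc c) :
    volume (wallKickOne ρ c '' Y) = volume Y := by
  have himg : wallKickOne ρ c '' Y = shiftPos c '' (Alexander.phaseBilliard ρ '' (shiftPos (-c) '' Y)) := by
    rw [image_image, image_image]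
    exact image_congr fun a _ => wallKickOne_eq ρ c a
  obtain ⟨hm1, hv1⟩ := volume_image_shiftPos (-c) hY
  have hsub1 : shiftPos (-c) '' Y ⊆ Alexander.phaseGood ρ ρc := by
    rintro _ ⟨a, ha, rfl⟩; exact hsub ha
  haveI := Alexander.standardBorelSpace_config (d := d) (N := 1)
  haveI : StandardBorelSpace (UnitAddTorus d × EuclideanSpace ℝ d) := standardBorel_of_polish
  have hm2 : MeasurableSet (Alexander.phaseBilliard ρ '' (shiftPos (-c) '' Y)) :=
    hm1.image_of_measurable_injOn (Alexander.measurable_phaseBilliard ρ)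
      ((Alexander.injOn_phaseBilliard hρ0 hρc).mono hsub1)
  rw [himg, (volume_image_shiftPos c hm2).2, Alexander.volume_image_phaseBilliard hρ0 hρc hm1 hsub1, hv1]

/-- On a wall hit piece of an energy shell the datum of the kicked sphere lies in the good domain
of the wall kick with chart bound `ρ + r`. [folklore] -/
theorem WallHitHyp.mem_wallKickGood {z : Config N d (UnitAddTorus d)} {q : Fin N × ι} (h : WallHitHyp ctr ε ρ r δ V z q) :
    z q.1 ∈ wallKickGood ρ (ρ + r) (ctr q.2) := by
  have hlift : Alexander.liftPhase (shiftPos (-ctr q.2) (z q.1)) =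
      ((Torus.geometry d).sepVec (z q.1).1 (ctr q.2), (z q.1).2) := liftPhase_shiftPos_neg (ctr q.2) (z q.1)
  refine ⟨by rw [hlift]; exact h.good, ?_⟩
  rw [hlift]
  simp only [billiardMap]
  have hw : ‖hitVel ρ ((Torus.geometry d).sepVec (z q.1).1 (ctr q.2), (z q.1).2)‖ ≤ V := by
    rw [norm_hitVel h.ρ_pos h.good]; exact h.norm_vel_le q.1
  calc ‖hitPoint ρ ((Torus.geometry d).sepVec (z q.1).1 (ctr q.2), (z q.1).2) -
        pairHitTime ρ ((Torus.geometry d).sepVec (z q.1).1 (ctr q.2)) (z q.1).2 •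
          hitVel ρ ((Torus.geometry d).sepVec (z q.1).1 (ctr q.2), (z q.1).2)‖
      ≤ ‖hitPoint ρ ((Torus.geometry d).sepVec (z q.1).1 (ctr q.2), (z q.1).2)‖ +
          ‖pairHitTime ρ ((Torus.geometry d).sepVec (z q.1).1 (ctr q.2)) (z q.1).2 •
            hitVel ρ ((Torus.geometry d).sepVec (z q.1).1 (ctr q.2), (z q.1).2)‖ := norm_sub_le _ _
    _ ≤ ρ + δ * V := by
        rw [h.norm_hitPoint, norm_smul, Real.norm_eq_abs, abs_of_nonneg h.hitTime_pos.le]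
        exact add_le_add_right (mul_le_mul h.hitTime_le hw (norm_nonneg _) h.δ_pos.le) ρ
    _ ≤ ρ + r := by nlinarith [h.window, h.V_nonneg, h.δ_pos]

/-- `wallCollide` is `applyAt` of the wall kick. [folklore] -/
theorem wallCollide_eq_applyAt (ρ : ℝ) (ctr : ι → UnitAddTorus d) (q : Fin N × ι) :
    wallCollide (N := N) ρ ctr q = Alexander.applyAt q.1 (wallKickOne ρ (ctr q.2)) := rfl

/-- **The wall kick of a configuration preserves the volume of sets** in a wall hit piece of an
energy shell, and has measurable image there (Liouville's theorem for one specular reflection of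
one of `N` hard spheres at a fixed round scatterer on the torus; CIP 1994 §4.2 p. 65, App. 4.A
p. 111). [cite: CIP1994, §4.2 p. 65] -/
theorem volume_image_wallCollide (hε : 0 < ε) (hεr : ε + 2 * r < 2⁻¹) (hρ0 : 0 < ρ) (hρr : ρ + 2 * r < 2⁻¹)
    (hr : 2 * V * δ ≤ r) (hV0 : 0 ≤ V) (q : Fin N × ι) {A : Set (Config N d (UnitAddTorus d))} (hA : MeasurableSet A)
    (hsub : A ⊆ wallHitPiece N ctr ε ρ r δ q ∩ {z | configEnergy z ≤ V ^ 2 / 2}) :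
    MeasurableSet (wallCollide ρ ctr q '' A) ∧ volume (wallCollide ρ ctr q '' A) = volume A := by
  rcases A.eq_empty_or_nonempty with rfl | ⟨z₀, hz₀⟩
  · simp
  have h₀ : WallHitHyp ctr ε ρ r δ V z₀ q := WallHitHyp.mk hε hεr hρ0 hρr hr hV0 (hsub hz₀).2 (hsub hz₀).1
  have hρc : ρ + r < 1 / 2 := by linarith [h₀.r_nonneg, h₀.chart]
  rw [wallCollide_eq_applyAt]
  refine Alexander.volume_image_applyAt (measurable_wallKickOne ρ (ctr q.2)) (injOn_wallKickOne hρ0 hρc (ctr q.2))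
    (fun Y hY hYm => volume_image_wallKickOne hρ0 hρc (ctr q.2) hYm hY) hA fun z hz => ?_
  exact (WallHitHyp.mk hε hεr hρ0 hρr hr hV0 (hsub hz).2 (hsub hz).1).mem_wallKickGood

end WallKick

/-! ## The confined flow over the window does not lose volume -/

section Step

/-- The confined short-time good set is the union of its pieces. [folklore] -/
theorem cShortGood_subset_iUnion_cShortPiece :
    cShortGood (d := d) N ctr ε ρ r δ ⊆ ⋃ κ, cShortPiece N ctr ε ρ r δ κ := by
  intro z hz
  rcases mem_cShortGood.1 hz with ⟨hsg, hw⟩ | ⟨q, hq | hq⟩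
  · obtain ⟨κ, hκ⟩ := mem_iUnion.1 (Alexander.shortGood_subset_iUnion_shortPiece hsg)
    exact mem_iUnion.2 ⟨Sum.inl κ, hκ, hw⟩
  · exact mem_iUnion.2 ⟨Sum.inr (q, false), hq⟩
  · exact mem_iUnion.2 ⟨Sum.inr (q, true), hq⟩

/-- The pieces are measurable. [folklore] -/
theorem measurableSet_cShortPiece [Countable ι] (κ : Option ((Fin N × Fin N) × Bool) ⊕ ((Fin N × ι) × Bool)) :
    MeasurableSet (cShortPiece (d := d) N ctr ε ρ r δ κ) := by
  rcases κ with κ | ⟨q, _ | _⟩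
  · exact (Alexander.measurableSet_shortPiece κ).inter (measurableSet_wallFar ctr ρ r)
  · exact measurableSet_wallNoHitPiece ctr ε ρ r δ q
  · exact measurableSet_wallHitPiece ctr ε ρ r δ q

/-- Every pair piece lies in the short-time good set of the pairs. [folklore] -/
theorem shortPiece_subset_shortGood (κ : Option ((Fin N × Fin N) × Bool)) :
    Alexander.shortPiece (d := d) N ε r δ κ ⊆ Alexander.shortGood N ε r δ := by
  intro z hz
  rcases κ with _ | ⟨p, _ | _⟩
  · exact Alexander.mem_shortGood.2 (Or.inl hz)
  · simp only [Alexander.shortPiece] at hz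
    split_ifs at hz with hp
    · exact Alexander.mem_shortGood.2 (Or.inr ⟨p, hp, Or.inl hz⟩)
    · exact absurd hz (notMem_empty z)
  · simp only [Alexander.shortPiece] at hz
    split_ifs at hz with hp
    · exact Alexander.mem_shortGood.2 (Or.inr ⟨p, hp, Or.inr hz⟩)
    · exact absurd hz (notMem_empty z)

/-- A configuration of the short-time good set of the pairs with all scatterers far is in no wall piece. [folklore] -/
theorem not_mem_wall_pieces_of_mem_wallFar {z : Config N d (UnitAddTorus d)} (hw : z ∈ wallFar N ctr ρ r) (q : Fin N × ι) :
    z ∉ wallNoHitPiece N ctr ε ρ r δ q ∧ z ∉ wallHitPiece N ctr ε ρ r δ q :=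
  ⟨not_mem_wallNoHitPiece_of_mem_wallFar hw q, not_mem_wallHitPiece_of_mem_wallFar hw q⟩

/-- The pieces are pairwise disjoint. [folklore] -/
theorem eq_of_mem_cShortPiece {z : Config N d (UnitAddTorus d)}
    {κ κ' : Option ((Fin N × Fin N) × Bool) ⊕ ((Fin N × ι) × Bool)}
    (hz : z ∈ cShortPiece N ctr ε ρ r δ κ) (hz' : z ∈ cShortPiece N ctr ε ρ r δ κ') : κ = κ' := by
  rcases κ with κ | ⟨q, _ | _⟩ <;> rcases κ' with κ' | ⟨q', _ | _⟩
  · exact congrArg Sum.inl (Alexander.eq_of_mem_shortPiece hz.1 hz'.1)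
  · exact absurd hz' (not_mem_wall_pieces_of_mem_wallFar hz.2 q').1
  · exact absurd hz' (not_mem_wall_pieces_of_mem_wallFar hz.2 q').2
  · exact absurd hz (not_mem_wall_pieces_of_mem_wallFar hz'.2 q).1
  · rw [eq_of_mem_wallNoHitPiece_of_mem_wallNoHitPiece hz hz']
  · exact absurd hz' (not_mem_wallHitPiece_of_mem_wallNoHitPiece hz q')
  · exact absurd hz (not_mem_wall_pieces_of_mem_wallFar hz'.2 q).2
  · exact absurd hz (not_mem_wallHitPiece_of_mem_wallNoHitPiece hz' q)
  · rw [eq_of_mem_wallHitPiece_of_mem_wallHitPiece hz hz']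

variable [Finite ι]

/-- **The confined flow at time `δ` is injective on the confined short-time good part of an energy shell.** [folklore] -/
theorem injOn_fwdFlow_cShortGood (hε : 0 < ε) (hεr : ε + 2 * r < 2⁻¹) (hρr : ρ + 2 * r < 2⁻¹) (hr : 2 * V * δ ≤ r)
    (hV0 : 0 ≤ V) (hδ : 0 ≤ δ) :
    InjOn (fun z : Config N d (UnitAddTorus d) => fwdFlow (Torus.geometry d) (Wall.balls (Torus.geometry d) ctr ρ hρ) ε z δ)
      (cShortGood N ctr ε ρ r δ ∩ {z | configEnergy z ≤ V ^ 2 / 2}) := by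
  rintro z ⟨hz, hE⟩ z' ⟨hz', hE'⟩ heq
  simp only at heq
  rw [fwdFlow_eq_freeFlight_cKick hρ hε hεr hρr hr hV0 hδ hE hz, fwdFlow_eq_freeFlight_cKick hρ hε hεr hρr hr hV0 hδ hE' hz'] at heq
  exact cKick_injOn hρ hε hεr hρr hr hV0 ⟨hz, hE⟩ ⟨hz', hE'⟩ (Alexander.freeFlight_injective δ heq)

/-- On each piece, the image under the confined flow at time `δ` of a measurable subset of an
energy shell is measurable and has the same volume. [folklore] -/
theorem volume_image_fwdFlow_cShortPiece (hε : 0 < ε) (hεr : ε + 2 * r < 2⁻¹) (hρr : ρ + 2 * r < 2⁻¹)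
    (hr : 2 * V * δ ≤ r) (hV0 : 0 ≤ V) (hδ : 0 ≤ δ) (κ : Option ((Fin N × Fin N) × Bool) ⊕ ((Fin N × ι) × Bool))
    {X : Set (Config N d (UnitAddTorus d))} (hX : MeasurableSet X)
    (hsub : X ⊆ cShortPiece N ctr ε ρ r δ κ ∩ {z | configEnergy z ≤ V ^ 2 / 2}) :
    MeasurableSet ((fun z => fwdFlow (Torus.geometry d) (Wall.balls (Torus.geometry d) ctr ρ hρ) ε z δ) '' X) ∧
      volume ((fun z => fwdFlow (Torus.geometry d) (Wall.balls (Torus.geometry d) ctr ρ hρ) ε z δ) '' X) = volume X := by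
  set W := Wall.balls (Torus.geometry d) ctr ρ hρ
  have hr0 : 0 ≤ r := le_trans (by positivity) hr
  have hε' : ε < 2⁻¹ := by linarith
  have hρ' : ρ < 2⁻¹ := by linarith
  -- the no-event case: the flow is free flight on `X`
  have free_case : (∀ z ∈ X, IsNoEventData ctr ε ρ r δ z) →
      MeasurableSet ((fun z => fwdFlow (Torus.geometry d) W ε z δ) '' X) ∧
        volume ((fun z => fwdFlow (Torus.geometry d) W ε z δ) '' X) = volume X := by
    intro H
    have himg : (fun z => fwdFlow (Torus.geometry d) W ε z δ) '' X = freeFlight (Torus.geometry d) δ '' X := by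
      refine image_congr fun z hz => ?_
      obtain ⟨Hp, Hw⟩ := (H z hz).forall hε hρ hεr hρr hr (norm_vel_le_of_configEnergy_le hV0 (hsub hz).2)
      exact fwdFlow_eq_freeFlight_of_forall hρ hε' hρ' hδ Hp Hw ⟨hδ, le_rfl⟩
    rw [himg]
    exact ⟨Alexander.measurableSet_image_freeFlight δ hX, Alexander.volume_image_freeFlight δ hX⟩
  rcases κ with κ | ⟨q, _ | _⟩
  · -- pair pieces with all scatterers far
    rcases κ with _ | ⟨p, _ | _⟩
    · exact free_case fun z hz => Or.inl ⟨Or.inl (hsub hz).1.1, (hsub hz).1.2⟩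
    · by_cases hp : p.1 < p.2
      · refine free_case fun z hz => Or.inl ⟨Or.inr ⟨p, hp, ?_⟩, (hsub hz).1.2⟩
        have := (hsub hz).1.1; simp only [Alexander.shortPiece, if_pos hp] at this; exact this
      · have hXe : X = ∅ := by
          refine eq_empty_of_forall_notMem fun z hz => ?_
          have := (hsub hz).1.1; simp only [Alexander.shortPiece, if_neg hp] at this; exact this
        subst hXe; simp
    · by_cases hp : p.1 < p.2
      · have hsub' : X ⊆ Alexander.hitPiece N ε r δ p.1 p.2 ∩ {z | configEnergy z ≤ V ^ 2 / 2} := by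
          intro z hz
          have := (hsub hz).1.1; simp only [Alexander.shortPiece, if_pos hp] at this
          exact ⟨this, (hsub hz).2⟩
        have himg : (fun z => fwdFlow (Torus.geometry d) W ε z δ) '' X =
            freeFlight (Torus.geometry d) δ '' (Alexander.pairCollide ε p.1 p.2 '' X) := by
          rw [image_image]
          exact image_congr fun z hz => PairHit.fwdFlow_eq_freeFlight_pairCollide hρ
            (Alexander.HitHyp.mk hε hεr hr hV0 (hsub' hz).2 hp (hsub' hz).1) (hsub hz).1.2 hρ'
        obtain ⟨hm, hv⟩ := Alexander.volume_image_pairCollide hε hεr hr hV0 hp hX hsub'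
        rw [himg]
        exact ⟨Alexander.measurableSet_image_freeFlight δ hm, by rw [Alexander.volume_image_freeFlight δ hm, hv]⟩
      · have hXe : X = ∅ := by
          refine eq_empty_of_forall_notMem fun z hz => ?_
          have := (hsub hz).1.1; simp only [Alexander.shortPiece, if_neg hp] at this; exact this
        subst hXe; simp
  · -- wall no-hit piece
    exact free_case fun z hz => Or.inr ⟨q, (hsub hz).1⟩
  · -- wall hit piece
    have hsub' : X ⊆ wallHitPiece N ctr ε ρ r δ q ∩ {z | configEnergy z ≤ V ^ 2 / 2} := fun z hz => ⟨(hsub hz).1, (hsub hz).2⟩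
    have himg : (fun z => fwdFlow (Torus.geometry d) W ε z δ) '' X =
        freeFlight (Torus.geometry d) δ '' (wallCollide ρ ctr q '' X) := by
      rw [image_image]
      exact image_congr fun z hz => (WallHitHyp.mk hε hεr hρ hρr hr hV0 (hsub' hz).2 (hsub' hz).1).fwdFlow_eq_freeFlight_wallCollide hρ
    obtain ⟨hm, hv⟩ := volume_image_wallCollide hε hεr hρ hρr hr hV0 q hX hsub'
    rw [himg]
    exact ⟨Alexander.measurableSet_image_freeFlight δ hm, by rw [Alexander.volume_image_freeFlight δ hm, hv]⟩

/-- **The confined hard-sphere flow over a short window does not lose volume** (GST 2013, proof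
of Prop. 4.1.1; CIP 1994 §4.2 p. 65, App. 4.A): for every measurable `B`, the confined short-time
good data of the energy shell `E ≤ V²/2` that the confined flow at time `δ` carries into `B`
have volume at most `vol B` (`0 < ε`, `ε + 2r < 1/2`, `ρ + 2r < 1/2`, `2Vδ ≤ r`, `0 ≤ δ`,
`0 ≤ V`). [cite: GST2013, proof of Prop. 4.1.1 p. 19] -/
theorem volume_cShortGood_inter_preimage_fwdFlow_le (hε : 0 < ε) (hεr : ε + 2 * r < 2⁻¹) (hρr : ρ + 2 * r < 2⁻¹)
    (hr : 2 * V * δ ≤ r) (hV0 : 0 ≤ V) (hδ : 0 ≤ δ) {B : Set (Config N d (UnitAddTorus d))} (hB : MeasurableSet B) :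
    volume {z : Config N d (UnitAddTorus d) | z ∈ cShortGood N ctr ε ρ r δ ∧ configEnergy z ≤ V ^ 2 / 2 ∧
      fwdFlow (Torus.geometry d) (Wall.balls (Torus.geometry d) ctr ρ hρ) ε z δ ∈ B} ≤ volume B := by
  classical
  haveI : Countable ι := Finite.to_countable
  haveI : Fintype ι := Fintype.ofFinite ι
  set W := Wall.balls (Torus.geometry d) ctr ρ hρ
  have hr0 : 0 ≤ r := le_trans (by positivity) hr
  have hε' : ε < 2⁻¹ := by linarith
  have hρ' : ρ < 2⁻¹ := by linarith
  have hG := Torus.isHardSphereRegular_geometry (d := d) hε'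
  have hGρ := Torus.isHardSphereRegular_geometry (d := d) hρ'
  set T : Config N d (UnitAddTorus d) → Config N d (UnitAddTorus d) := fun z => fwdFlow (Torus.geometry d) W ε z δ with hT
  have hTm : Measurable T := measurable_fwdFlow hG hGρ Torus.isMeasurable_geometry δ
  set A : Set (Config N d (UnitAddTorus d)) := {z | z ∈ cShortGood N ctr ε ρ r δ ∧
    configEnergy z ≤ V ^ 2 / 2 ∧ fwdFlow (Torus.geometry d) W ε z δ ∈ B} with hA
  have hAm : MeasurableSet A :=
    (measurableSet_cShortGood ctr ε ρ r δ).inter ((Alexander.measurableSet_energyShell _).inter (hTm hB))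
  have key : ∀ κ, MeasurableSet (T '' (A ∩ cShortPiece N ctr ε ρ r δ κ)) ∧
      volume (T '' (A ∩ cShortPiece N ctr ε ρ r δ κ)) = volume (A ∩ cShortPiece N ctr ε ρ r δ κ) :=
    fun κ => volume_image_fwdFlow_cShortPiece hε hεr hρr hr hV0 hδ κ (hAm.inter (measurableSet_cShortPiece κ))
      fun z hz => ⟨hz.2, hz.1.2.1⟩
  have hdisj : Pairwise (Disjoint on fun κ => T '' (A ∩ cShortPiece N ctr ε ρ r δ κ)) := by
    intro κ κ' hne
    rw [Function.onFun, disjoint_left]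
    rintro _ ⟨z, ⟨hzA, hzP⟩, rfl⟩ ⟨z', ⟨hz'A, hz'P⟩, heq⟩
    have hzz : z' = z := injOn_fwdFlow_cShortGood hε hεr hρr hr hV0 hδ ⟨hz'A.1, hz'A.2.1⟩ ⟨hzA.1, hzA.2.1⟩ heq
    subst hzz
    exact hne (eq_of_mem_cShortPiece hzP hz'P)
  calc volume A ≤ volume (⋃ κ, A ∩ cShortPiece N ctr ε ρ r δ κ) := by
        refine measure_mono fun z hz => ?_
        obtain ⟨κ, hκ⟩ := mem_iUnion.1 (cShortGood_subset_iUnion_cShortPiece hz.1)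
        exact mem_iUnion.2 ⟨κ, hz, hκ⟩
    _ ≤ ∑ κ, volume (A ∩ cShortPiece N ctr ε ρ r δ κ) := measure_iUnion_fintype_le _ _
    _ = ∑ κ, volume (T '' (A ∩ cShortPiece N ctr ε ρ r δ κ)) := Finset.sum_congr rfl fun κ _ => (key κ).2.symm
    _ = volume (⋃ κ, T '' (A ∩ cShortPiece N ctr ε ρ r δ κ)) := by
        rw [measure_iUnion hdisj fun κ => (key κ).1, tsum_fintype]
    _ ≤ volume B := by
        refine measure_mono (iUnion_subset fun κ => ?_)
        rintro _ ⟨z, ⟨hzA, -⟩, rfl⟩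
        exact hzA.2.2

end Step

end ConfinedAlexander

end Kinetic

end

end Literature.Analysis.FluidPDE
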